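import Summits.FinalStateConjecture.FinalStateConjecture.Theses.ClusterCompleteness
import Summits.FinalStateConjecture.FinalStateConjecture.Theorems.ClusterCompletenessOmegaLimitMultiKerrBirthDefs
import Summits.FinalStateConjecture.FinalStateConjecture.Theorems.ClusterCompletenessOmegaLimitMultiKerrStubHoleCone
import Summits.FinalStateConjecture.FinalStateConjecture.Theorems.ClusterCompletenessOmegaLimitMultiKerrStubLandau
import Summits.FinalStateConjecture.FinalStateConjecture.Theorems.ClusterCompletenessOmegaLimitMultiKerrStubConeInterp
import Summits.FinalStateConjecture.FinalStateConjecture.Theorems.ClusterCompletenessOmegaLimitMultiKerrStubOrderUpgradeAssembly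

/-!
# Birth skeleton (BC3) for crux `ClusterCompleteness.OmegaLimitMultiKerr`
# (stmt-FinalStateConjecture-17639, route `ClusterCompleteness`, rank 9; re-typed rev 21 / Statement T2)

Registered by the skeleton registrar (planner one-shot, 2026-08-17). Two NAMED stubs and the
kernel-checked composition `OmegaLimitMultiKerr_of` concluding the crux BY NAME.

## The crux (FIXED; read back `omegaLimitMultiKerr_iff`, `Iff.rfl`)

For every order `k` and every connected Hausdorff second-countable smooth `3`-manifold,
TAME-Christodoulou-generically in the admissible class: an MGHD exists, and every MGHD that does
not settle down in the re-typed sense (`SettlesT2`: complete `𝓘⁺` + sub-extremal `C²`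
decomposition of `O = exteriorOf charted` with `RaysStayInClosure`, honest exhaustive charts,
future-oriented chart time) RECURS at order `k` in the anchored, oriented interface (`RecursO k`,
the 13 clauses C1–C13 below, verbatim the crux's conclusion = the hypothesis of the route's target
`RecurrentMultiKerrCapture`).

## Why this cut (one generic stub + one pointwise stub)

Christodoulou's curve-genericity is NOT closed under conjunction
(`Theorems.TameCensorship.Negative.isChristodoulouGeneric_and_fails`, kernel-checked), so the
only sound way to split a generic statement is ONE generic stub whose matrix is pointwise
STRONGER, plus `∀`-data lemmas bringing the matrix back; the composition is monotonicity of tame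
genericity in the property. The registrar rejects the cuts already tried on this crux: MGHD
existence + the rest (the rest is the crux modulo Choquet-Bruhat–Geroch: shredding; leads 0/c1);
the single-development `∃`-form + transport along isometries of developments (EQUIVALENT to the
crux, `omegaAt_iff_generic_exists_settles_or_recurs`, p112042: costume); era + pointwise
identification with an abstract guard (`Cruxes/OmegaLimitMultiKerr/ReLineTameEra.lean`: the
unguarded identification is FALSE at extremal-limit data, and the guard is not typable yet).

The cut registered here isolates the two things the line leads' ω-limit analysis (gens 3–7,
`…OmegaLimitMultiKerrOrderUpgrade/Translates/TranslateCompactness`) showed to be orthogonal: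

* `stub_genericSettlesOrTameRecurs` (GENERIC, summit pre-phase, FSC-implied through the settle
  disjunct hence never too strong): tame-generically an MGHD exists and every MGHD that does not
  settle (T2) carries the anchored oriented chart system C1–C12 which is moreover TAME — eventual
  all-time `C^{k+1}` bounds of the flat deviation on the flat slabs and of every hole deviation on
  the truncated slabs of every radius (precompactness of the late-time translates: ω-limits
  exist), with a uniform interior-ball condition on the late flat domain — and in which closeness
  to the ONE reference sub-extremal multi-Kerr configuration recurs only COARSELY: in `C⁰`, on
  THICK chart-time windows `[τ − 1, τ + 1]`, for every `ε` and every near-zone radius, together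
  with the orientation of the transported Kerr time vectors at the window centres (`TameRecursO k`).
  Content: weak cosmic censorship to the late phase, a-priori bounds in era gauge, the coarse
  anchor, separation, exhaustion, rays, orientation, and coarse recurrence of the dark-limit set
  to the reference configuration. NOT implied by the crux (tameness, thick windows), does not
  imply it cheaply (order `0` on windows versus order `k` on slabs: needs the second stub).
* `stub_orderUpgrade` (POINTWISE, every development, no genericity; M/L): a tame coarse recurrent
  system IS a recurrent system at order `k` with the same charts — `TameRecursO k 𝒟 → RecursO k 𝒟`.
  Mechanism: `C⁰`–`C^{k+1}` interpolation (Landau–Kolmogorov / Gagliardo–Nirenberg in sup norms)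
  on unit windows: `‖D^j h‖ ≲ ‖h‖_{C⁰}^{1-j/(k+1)} ‖h‖_{C^{k+1}}^{j/(k+1)} + ‖h‖_{C⁰}` for `j ≤ k`,
  with constants uniform in `τ` because the window geometry is translated by the Killing field
  `Λᵢ∂₀` of `boostedKerrBackground` (`…Translates`), an outward interior cone at the open horizon
  boundary `{rᵢ > r₊}`, and the interior-ball condition on `U₀`. Why THICK windows are needed:
  `deviationCk` is a sup over a slab of FULL `iteratedFDeriv`s on `E4`, so `C⁰`-smallness on a
  single slab does not control `∂_t` (counter-model `h = (t* − τ)·b`). Why the ball condition: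
  the flat deviation is a sup over ALL of `U₀ ∩ {x⁰ = τ}` and `U₀` cannot be shrunk without
  re-proving C8/C10, while cusps of an arbitrary open `U₀` defeat interpolation. The leads'
  `…OrderUpgrade` (p-landed) is the compact-set Arzelà–Ascoli shadow of this stub.

Composition `OmegaLimitMultiKerr_of : Sig.stub_genericSettlesOrTameRecurs → Sig.stub_orderUpgrade →
OmegaLimitMultiKerr` (the `Sig.*` are the stub statements verbatim): monotonicity of tame genericity
(`∀ d ∈ 𝓓, P d → Q d`), four lines. `OmegaLimitMultiKerr_of_stubs` plugs the registered stubs in.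

BC3 probes (registrar, 2026-08-17, `bc/stub_*_probe.lean` in the seat folder, vocabulary copied verbatim,
skeleton theorems NOT imported): for each stub signature `S ∈ {Sig.stub_genericSettlesOrTameRecurs,
Sig.stub_orderUpgrade}` and each target `T ∈ {OmegaLimitMultiKerr, FinalStateConjecture}`, the seven
cheap closers `exact?` · `simpa` · `simpa [S]` · `(unfold S; simpa)` · `aesop` · `intro h; simpa using h` ·
`intro h; simpa [S, T] using h` (maxHeartbeats 400000 each) ALL FAIL — 28/28 (`exact?` could not close
the goal; assumption failed; aesop: failed after exhaustive search; type mismatch after simplification).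
No stub is cheaply the crux or the summit.

Disproof used: none on file (`ledger crux ls`: no `Disproof.lean` for this crux, 2026-08-17T02:20Z).
Negatives honoured: no stub is a conjunction-of-generics glue (`isChristodoulouGeneric_and_fails`);
no stub re-words a refuted ClusterCompleteness statement (`ledger negatives`): the refuted rev-11
forms lacked the anchor F1–F3 — both stubs carry C1–C12 verbatim.
-/

-- the problem namespace `FinalStateConjecture.FinalStateConjecture` (single-conjunct summit) trips dupNamespace
set_option linter.dupNamespace false

noncomputable section

open scoped Manifold ContDiff Topology ENNReal
open Set Filter Function TopologicalSpace

namespace Summit.FinalStateConjecture.FinalStateConjecture.Cruxes.OmegaLimitMultiKerr.Birth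

open Literature.Geometry.Lorentzian
open Summit.FinalStateConjecture.FinalStateConjecture.Theses.ClusterCompleteness (OmegaLimitMultiKerr)
open Summit.FinalStateConjecture.FinalStateConjecture.Theorems.ClusterCompleteness (SettlesT2 RecursO
  TameRecursO omegaLimitMultiKerr_iff)

/-! ### Vocabulary

`RecursO k 𝒟`, `TameRecursO k 𝒟` and the read-back `omegaLimitMultiKerr_iff` (the crux IS "for every
`k` and `X`, tame-generically, an MGHD exists and every MGHD not settling in the T2 sense recurs at
order `k` in the oriented interface", `Iff.rfl`) now live in the landed vocabulary file
`Theorems/ClusterCompletenessOmegaLimitMultiKerrBirthDefs.lean` (p145440, lead c1) and are opened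
below, so that the stubs land with statements reading verbatim as registered. -/

section Genericity

variable {X : Type} [TopologicalSpace X] [ChartedSpace E3 X] [IsManifold (𝓡 3) ∞ X]

/-- Tame Christodoulou genericity is monotone under pointwise implication on the admissible class
(the same tame immersed family through an exceptional datum works; local copy of
`InitialDataSet.IsTameChristodoulouGeneric.mono`, keeping this file's imports at the route file
and the T2 vocabulary). [folklore] -/
theorem isTameChristodoulouGeneric_mono {𝓓 : Set (InitialDataSet (𝓡 3) X)}
    {P Q : InitialDataSet (𝓡 3) X → Prop} {m : ℕ}
    (h : InitialDataSet.IsTameChristodoulouGeneric 𝓓 P m) (hPQ : ∀ d ∈ 𝓓, P d → Q d) :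
    InitialDataSet.IsTameChristodoulouGeneric 𝓓 Q m := by
  intro d hd
  obtain ⟨e, F, hF, himm, h0, hinj, hadm, hexc⟩ := h d ⟨hd.1, fun hP ↦ hd.2 (hPQ d hd.1 hP)⟩
  exact ⟨e, F, hF, himm, h0, hinj, hadm,
    fun c hc hmem ↦ hexc c hc ⟨hmem.1, fun hP ↦ hmem.2 (hPQ _ hmem.1 hP)⟩⟩

end Genericity

/-! ### The stub SIGNATURES

Each stub's statement is ALSO recorded as the `Prop` `Sig.stub_<name>` (verbatim the statement of the
registered `theorem stub_<name>` below), so that the composition `OmegaLimitMultiKerr_of` takes the two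
statements as hypotheses whose heads are the stub names (layer-invariant skeleton audit). Obligation tags
(`@[stub]`) are gate-stamped, not written here. -/

/-- Signature of STUB 1 (generic; see `stub_genericSettlesOrTameRecurs`). -/
def Sig.stub_genericSettlesOrTameRecurs : Prop :=
    ∀ (k : ℕ) (X : Type) [TopologicalSpace X] [ChartedSpace E3 X] [IsManifold (𝓡 3) ∞ X]
      [T2Space X] [SecondCountableTopology X] [ConnectedSpace X],
      InitialDataSet.IsTameChristodoulouGeneric (admissibleVacuumData X)
        (fun D ↦ (∃ 𝒟 : VacuumCauchyDevelopment D, 𝒟.IsMaximal) ∧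
          ∀ 𝒟 : VacuumCauchyDevelopment D, 𝒟.IsMaximal → ¬ SettlesT2 𝒟 → TameRecursO k 𝒟) 1

/-- Signature of STUB 2 (pointwise order upgrade; kept as the TARGET of the assembly stub
`stub_orderUpgradeAssembly`; see there). -/
def Sig.stub_orderUpgrade : Prop :=
    ∀ (k : ℕ) (X : Type) [TopologicalSpace X] [ChartedSpace E3 X] [IsManifold (𝓡 3) ∞ X]
      [T2Space X] [SecondCountableTopology X] [ConnectedSpace X]
      (D : InitialDataSet (𝓡 3) X) (𝒟 : VacuumCauchyDevelopment D),
      TameRecursO k 𝒟 → RecursO k 𝒟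

/-! ### Reshape by the line lead (gen 1, 2026-08-17): the order upgrade is cut into three
worker-sized ANALYTIC/GEOMETRIC stubs and one lead-held ASSEMBLY stub

**STATE after lead c1 (2026-08-17T08:00Z): the pointwise half of the cut is DONE.** Landed:
`stub_landau` (p145615), `stub_coneInterp` (p145643), `stub_holeCone` (p145500) — wave 1 of
stub-workers — and the lead's `stub_orderUpgradeAssembly` together with the UNCONDITIONAL
`stub_orderUpgrade : ∀ k X … 𝒟, TameRecursO k 𝒟 → RecursO k 𝒟` (p147240, file
`Theorems/ClusterCompletenessOmegaLimitMultiKerrStubOrderUpgradeAssembly.lean`, which also carries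
`tameRecursOGeneric_of_finalStateConjecture : FinalStateConjecture → Sig.stub_genericSettlesOrTameRecurs`
expanded, `recurrentMultiKerrCapture_iff_recursO` (`Iff.rfl`) and `recursO_anti`/`tameRecursO_anti`);
the vocabulary is `Theorems/ClusterCompletenessOmegaLimitMultiKerrBirthDefs.lean` (p145440) and the
line's composition is importable as `omegaLimitMultiKerr_of_tameRecursOGeneric :
Sig.stub_genericSettlesOrTameRecurs (expanded) → OmegaLimitMultiKerr` (p147761,
`Theorems/ClusterCompletenessOmegaLimitMultiKerrOfTameRecursOGeneric.lean`). This skeleton therefore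
proves the crux BY NAME modulo exactly ONE sorry, the generic stub `stub_genericSettlesOrTameRecurs`
(the summit pre-phase), handed back to the planners (`promote-stub`).

* `stub_landau` (2a, pure Mathlib, one variable): a Landau-type interpolation inequality for the
  FIRST derivative at the left endpoint of `[0, T]` of a `Cⁿ` curve in a normed space, `n ≥ 2`:
  `‖φ'(0)‖ ≤ Cₙ (sup ‖φ‖ / T + sup ‖φ⁽ⁿ⁾‖ · T^{n-1})`, `Cₙ` depending on `n` only (Taylor to order
  `n − 1` at `0`, evaluated at the `n − 1` nodes `i T/(n−1)`, and inversion of the Vandermonde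
  system; or any other proof).
* `stub_coneInterp` (2b, pure Mathlib on `E4`, takes 2a as a hypothesis verbatim): UNIFORM CONE
  INTERPOLATION — for `k, L, B, ε` there is `δ > 0` such that every `f`, `C^{k+1}` on an open
  `Ω ⊆ E4`, with `‖f‖ ≤ δ` and `‖Dᵐ f‖ ≤ B` (`m ≤ k + 1`) on a truncated cone
  `x + {w | ‖w‖ ≤ L, ‖w‖ ≤ 2⟪w, u⟫}` (`‖u‖ = 1`) inside `Ω`, has `‖Dʲ f (x)‖ ≤ ε` for all `j ≤ k`
  (induction on `j`: 2a along unit directions `v` of the cone bounds `D^{j+1} f (z)(v, ·)`; an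
  arbitrary first argument is `v' = (v' + 3‖v'‖u) − 3‖v'‖u`, two cone vectors; the cone is convex
  and additive, budgets `L/(k+1)` per order).
* `stub_holeCone` (2c, Kerr–Schild geometry): every point of a boosted sub-extremal Kerr exterior
  carries such an outward truncated cone of a length `L(Λ, c, M, a) > 0` INSIDE the exterior, along
  which the rest-frame chart time moves by `≤ 1/2` and the Kerr–Schild radius grows by `≤ |a| + 1`
  (the complement `{r ≤ r₊}` is a solid confocal ellipsoid × time axis — convex,
  `Theorems.stub_kerrRadius_sublevel_convex` — so a supporting half-space of rest-frame directions
  never re-enters it; `r ≤ ‖x⃗‖ ≤ √(r² + a²)`; `|Δt*| ≤ ‖Λ⁻¹‖ ‖w‖`).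
* `stub_orderUpgradeAssembly` (2d, lead): 2b → 2c → (`TameRecursO k 𝒟 → RecursO k 𝒟`), the two
  hypotheses expanded verbatim (lead c1 reshape, so that the landed helper needs only the
  `RecursO`/`TameRecursO` vocabulary of `Theorems/…OmegaLimitMultiKerrBirthDefs.lean`): same
  witnesses, C1–C12 copied; for C13 at `(R', ε)` apply T4 at radius `R' + 1 + ∑ᵢ |aᵢ|` with the `δ`
  of 2b for `L = min (r₀/2) (minᵢ Lᵢ)`, `B = max B_flat B_holes`, frequently-and-eventually late;
  flat points get their cone from the T3 ball (`x ∈ ball y r₀ ⊆ U₀`, `u = (y − x)/‖y − x‖`,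
  `L ≤ r₀/2`), hole points from 2c; smoothness from `contDiffAt_deviationExtend_model` /
  `contDiffOn_deviationExtend_boostedKerr`; `supCkENorm` ↔ pointwise bounds by
  `enorm_iteratedFDeriv_le_supCkENorm`. -/

/-- Signature of STUB 2a (`stub_landau`). -/
def Sig.stub_landau : Prop :=
    ∀ n : ℕ, 2 ≤ n → ∃ C : ℝ, 0 < C ∧
      ∀ (W : Type) [NormedAddCommGroup W] [NormedSpace ℝ W] (φ : ℝ → W) (T A B : ℝ), 0 < T →
        (∀ t ∈ Set.Icc (0 : ℝ) T, ContDiffAt ℝ n φ t) →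
        (∀ t ∈ Set.Icc (0 : ℝ) T, ‖φ t‖ ≤ A) →
        (∀ t ∈ Set.Icc (0 : ℝ) T, ‖iteratedDeriv n φ t‖ ≤ B) →
        ‖deriv φ 0‖ ≤ C * (A / T + B * T ^ (n - 1))

/-- Signature of STUB 2b (`stub_coneInterp`, the conclusion; the registered stub is
`Sig.stub_landau → Sig.stub_coneInterp`, both expanded verbatim). -/
def Sig.stub_coneInterp : Prop :=
    ∀ (W : Type) [NormedAddCommGroup W] [NormedSpace ℝ W] (k : ℕ) (L B ε : ℝ), 0 < L → 0 < ε →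
      ∃ δ : ℝ, 0 < δ ∧ ∀ (f : E4 → W) (Ω : Set E4) (x u : E4), IsOpen Ω →
        ContDiffOn ℝ (k + 1) f Ω → ‖u‖ = 1 →
        (∀ w : E4, ‖w‖ ≤ L → ‖w‖ ≤ 2 * inner ℝ w u →
          x + w ∈ Ω ∧ ‖f (x + w)‖ ≤ δ ∧ ∀ m ≤ k + 1, ‖iteratedFDeriv ℝ m f (x + w)‖ ≤ B) →
        ∀ j ≤ k, ‖iteratedFDeriv ℝ j f x‖ ≤ ε

/-- Signature of STUB 2c (`stub_holeCone`). -/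
def Sig.stub_holeCone : Prop :=
    ∀ (Λ : lorentzGroup) (c : E4) (M a : ℝ), Kerr.IsSubextremal M a → ∃ L : ℝ, 0 < L ∧
      ∀ x ∈ (boostedKerrExterior Λ c M a : Set E4), ∃ u : E4, ‖u‖ = 1 ∧
        ∀ w : E4, ‖w‖ ≤ L → ‖w‖ ≤ 2 * inner ℝ w u →
          x + w ∈ (boostedKerrExterior Λ c M a : Set E4) ∧
          |(boostedKerrBackground Λ c M a).time (x + w) -
              (boostedKerrBackground Λ c M a).time x| ≤ 1 / 2 ∧
          (boostedKerrBackground Λ c M a).radius (x + w) ≤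
            (boostedKerrBackground Λ c M a).radius x + (|a| + 1)

/-! ### The registered stubs (the ONLY sorries of this file) -/

/-- **STUB 1 (generic; the summit pre-phase of this line).** For every order `k` and every
connected Hausdorff second-countable `3`-manifold, TAME-Christodoulou-generically in the admissible
class: an MGHD exists, and every MGHD that does NOT settle down in the T2 sense carries a TAME,
anchored, oriented, separating, exhaustive, ray-complete late chart system on ONE sub-extremal
multi-Kerr configuration in which `C⁰`-closeness recurs on thick windows for every `ε` and every
radius (`TameRecursO k`). Implied by `FinalStateConjecture` (the settle branch short-circuits the
matrix; tame genericity is monotone), so refutable only together with the summit. Why it might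
fail short of that: generic developments with non-precompact late-time translates in every era
gauge (no `C^{k+1}` bounds: persistent high-frequency radiation in the near zones), eternal bound or
chaotic `N`-body motion, generic extremal limits `|aᵢ| → Mᵢ`, complete null rays inside black holes.
Sources: Dafermos–Luk arXiv:1710.01722 §1.2.1; Christodoulou CQG 16 (1999) A23;
Klainerman–Szeftel arXiv:2104.11857; Alexakis–Schlue arXiv:1504.04592. -/
theorem stub_genericSettlesOrTameRecurs :
    ∀ (k : ℕ) (X : Type) [TopologicalSpace X] [ChartedSpace E3 X] [IsManifold (𝓡 3) ∞ X]
      [T2Space X] [SecondCountableTopology X] [ConnectedSpace X],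
      InitialDataSet.IsTameChristodoulouGeneric (admissibleVacuumData X)
        (fun D ↦ (∃ 𝒟 : VacuumCauchyDevelopment D, 𝒟.IsMaximal) ∧
          ∀ 𝒟 : VacuumCauchyDevelopment D, 𝒟.IsMaximal → ¬ SettlesT2 𝒟 → TameRecursO k 𝒟) 1 := by
  sorry

/-- **STUB 2a (one-variable Landau-type interpolation inequality at an endpoint) — LANDED** (p145615,
`Theorems/ClusterCompletenessOmegaLimitMultiKerrStubLandau.lean`, wave 1). For every
`n ≥ 2` there is `C > 0` such that for every normed space `W`, every `T > 0` and every curve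
`φ : ℝ → W` that is `Cⁿ` at each point of `[0, T]`, with `‖φ‖ ≤ A` and `‖φ⁽ⁿ⁾‖ ≤ B` on `[0, T]`:
`‖φ'(0)‖ ≤ C (A / T + B T^{n−1})`. Landau 1913 (n = 2), Kolmogorov 1939; here only the crude
endpoint form with non-sharp constant is wanted (Taylor's formula with remainder
`taylor_mean_remainder_bound` at the nodes `i T/(n−1)`, `i = 1 … n−1`, and the inverse of the
Vandermonde matrix `(i^m)`, `Matrix.det_vandermonde_ne_zero_iff`). [folklore] -/
theorem stub_landau :
    ∀ n : ℕ, 2 ≤ n → ∃ C : ℝ, 0 < C ∧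
      ∀ (W : Type) [NormedAddCommGroup W] [NormedSpace ℝ W] (φ : ℝ → W) (T A B : ℝ), 0 < T →
        (∀ t ∈ Set.Icc (0 : ℝ) T, ContDiffAt ℝ n φ t) →
        (∀ t ∈ Set.Icc (0 : ℝ) T, ‖φ t‖ ≤ A) →
        (∀ t ∈ Set.Icc (0 : ℝ) T, ‖iteratedDeriv n φ t‖ ≤ B) →
        ‖deriv φ 0‖ ≤ C * (A / T + B * T ^ (n - 1)) :=
  Theorems.ClusterCompleteness.stub_landau

/-- **STUB 2b (uniform cone interpolation on `E4`, from 2a) — LANDED** (p145643,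
`Theorems/ClusterCompletenessOmegaLimitMultiKerrStubConeInterp.lean`, wave 1). Assuming the one-variable
inequality 2a verbatim: for every normed space `W`, order `k`, cone length `L > 0`, bound `B` and
`ε > 0` there is `δ > 0` such that for every `f : E4 → W` of class `C^{k+1}` on an open `Ω`, every
point `x` and unit vector `u` whose truncated cone `x + {w | ‖w‖ ≤ L, ‖w‖ ≤ 2⟪w, u⟫}` lies in `Ω`
and carries the bounds `‖f‖ ≤ δ`, `‖Dᵐ f‖ ≤ B` (`m ≤ k + 1`), all derivatives of order `≤ k` at
`x` have operator norm `≤ ε`. Gagliardo 1959 / Nirenberg 1959 (sup-norm case on cones), via 2a on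
segments: induction on the order with budget `L/(k+1)` per step, first argument decomposed as
`v' = (v' + 3‖v'‖u) − 3‖v'‖u`. [folklore] -/
theorem stub_coneInterp :
    (∀ n : ℕ, 2 ≤ n → ∃ C : ℝ, 0 < C ∧
      ∀ (W : Type) [NormedAddCommGroup W] [NormedSpace ℝ W] (φ : ℝ → W) (T A B : ℝ), 0 < T →
        (∀ t ∈ Set.Icc (0 : ℝ) T, ContDiffAt ℝ n φ t) →
        (∀ t ∈ Set.Icc (0 : ℝ) T, ‖φ t‖ ≤ A) →
        (∀ t ∈ Set.Icc (0 : ℝ) T, ‖iteratedDeriv n φ t‖ ≤ B) →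
        ‖deriv φ 0‖ ≤ C * (A / T + B * T ^ (n - 1))) →
    ∀ (W : Type) [NormedAddCommGroup W] [NormedSpace ℝ W] (k : ℕ) (L B ε : ℝ), 0 < L → 0 < ε →
      ∃ δ : ℝ, 0 < δ ∧ ∀ (f : E4 → W) (Ω : Set E4) (x u : E4), IsOpen Ω →
        ContDiffOn ℝ (k + 1) f Ω → ‖u‖ = 1 →
        (∀ w : E4, ‖w‖ ≤ L → ‖w‖ ≤ 2 * inner ℝ w u →
          x + w ∈ Ω ∧ ‖f (x + w)‖ ≤ δ ∧ ∀ m ≤ k + 1, ‖iteratedFDeriv ℝ m f (x + w)‖ ≤ B) →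
        ∀ j ≤ k, ‖iteratedFDeriv ℝ j f x‖ ≤ ε :=
  Theorems.ClusterCompleteness.stub_coneInterp

/-- **STUB 2c (outward cones in a boosted sub-extremal Kerr exterior) — LANDED** (p145500,
`Theorems/ClusterCompletenessOmegaLimitMultiKerrStubHoleCone.lean`, wave 1). For a Lorentz motion
`(Λ, c)` and sub-extremal `(M, a)` there is `L > 0` such that every point `x` of the boosted exterior
`boostedKerrExterior Λ c M a` admits a unit vector `u` whose truncated cone
`x + {w | ‖w‖ ≤ L, ‖w‖ ≤ 2⟪w, u⟫}` stays in the exterior, with rest-frame chart time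
`t*(x + w)` within `1/2` of `t*(x)` and Kerr–Schild radius `r(x + w) ≤ r(x) + |a| + 1`
(the closed complement `{r ≤ r₊}` of the rest-frame exterior is convex —
`Theorems.stub_kerrRadius_sublevel_convex`, O'Neill 1995, Ch. 2, §2.1 — so the pull-back by `Λ⁻¹` of
a separating half-space of directions works; `r ≤ ‖x⃗‖ ≤ √(r² + a²)`, `Kerr.radius_le_spatialNorm`,
`Kerr.spatialNorm_sq_sub_sq_le_radius_sq`; `L = 1 / (2 (1 + ‖Λ⁻¹‖))`). [folklore] -/
theorem stub_holeCone :
    ∀ (Λ : lorentzGroup) (c : E4) (M a : ℝ), Kerr.IsSubextremal M a → ∃ L : ℝ, 0 < L ∧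
      ∀ x ∈ (boostedKerrExterior Λ c M a : Set E4), ∃ u : E4, ‖u‖ = 1 ∧
        ∀ w : E4, ‖w‖ ≤ L → ‖w‖ ≤ 2 * inner ℝ w u →
          x + w ∈ (boostedKerrExterior Λ c M a : Set E4) ∧
          |(boostedKerrBackground Λ c M a).time (x + w) -
              (boostedKerrBackground Λ c M a).time x| ≤ 1 / 2 ∧
          (boostedKerrBackground Λ c M a).radius (x + w) ≤
            (boostedKerrBackground Λ c M a).radius x + (|a| + 1) :=
  Theorems.ClusterCompleteness.stub_holeCone

/-- **STUB 2d (assembly of the order upgrade; lead-held) — LANDED**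
(`Theorems/ClusterCompletenessOmegaLimitMultiKerrStubOrderUpgradeAssembly.lean`, lead c1; the same file lands the
registrar's original pointwise stub `stub_orderUpgrade` UNCONDITIONALLY). Uniform cone interpolation (2b) and
the Kerr cone geometry (2c) give the pointwise order upgrade `TameRecursO k 𝒟 → RecursO k 𝒟` with
the SAME charts, labels, motions, radii and region: C1–C12 are copied; for C13 at `(R', ε)` one
applies T4 at the radius `R' + 1 + ∑ᵢ |aᵢ|` with the `δ` of 2b for the common cone length
`min (r₀/2) (minᵢ Lᵢ)` and the common bound `max B_flat B_holes` (T1, T2), frequently at chart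
times later than all the tameness thresholds `+ 1`; flat points get their cone from the interior
ball of T3, hole points from 2c. The two hypotheses are `Sig.stub_coneInterp` and
`Sig.stub_holeCone` EXPANDED VERBATIM (lead reshape c1, 2026-08-17: the landed helper file must not
mention the skeleton-local `Sig.*` abbreviations; `stub_orderUpgrade_of` is unchanged, the `Sig.*`
unfold definitionally). [folklore] -/
theorem stub_orderUpgradeAssembly :
    (∀ (W : Type) [NormedAddCommGroup W] [NormedSpace ℝ W] (k : ℕ) (L B ε : ℝ), 0 < L → 0 < ε →
      ∃ δ : ℝ, 0 < δ ∧ ∀ (f : E4 → W) (Ω : Set E4) (x u : E4), IsOpen Ω →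
        ContDiffOn ℝ (k + 1) f Ω → ‖u‖ = 1 →
        (∀ w : E4, ‖w‖ ≤ L → ‖w‖ ≤ 2 * inner ℝ w u →
          x + w ∈ Ω ∧ ‖f (x + w)‖ ≤ δ ∧ ∀ m ≤ k + 1, ‖iteratedFDeriv ℝ m f (x + w)‖ ≤ B) →
        ∀ j ≤ k, ‖iteratedFDeriv ℝ j f x‖ ≤ ε) →
    (∀ (Λ : lorentzGroup) (c : E4) (M a : ℝ), Kerr.IsSubextremal M a → ∃ L : ℝ, 0 < L ∧
      ∀ x ∈ (boostedKerrExterior Λ c M a : Set E4), ∃ u : E4, ‖u‖ = 1 ∧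
        ∀ w : E4, ‖w‖ ≤ L → ‖w‖ ≤ 2 * inner ℝ w u →
          x + w ∈ (boostedKerrExterior Λ c M a : Set E4) ∧
          |(boostedKerrBackground Λ c M a).time (x + w) -
              (boostedKerrBackground Λ c M a).time x| ≤ 1 / 2 ∧
          (boostedKerrBackground Λ c M a).radius (x + w) ≤
            (boostedKerrBackground Λ c M a).radius x + (|a| + 1)) →
    ∀ (k : ℕ) (X : Type) [TopologicalSpace X] [ChartedSpace E3 X] [IsManifold (𝓡 3) ∞ X]
      [T2Space X] [SecondCountableTopology X] [ConnectedSpace X]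
      (D : InitialDataSet (𝓡 3) X) (𝒟 : VacuumCauchyDevelopment D),
      TameRecursO k 𝒟 → RecursO k 𝒟 :=
  Theorems.ClusterCompleteness.stub_orderUpgradeAssembly

/-! ### The composition: the skeleton concludes the crux BY NAME -/

/-- **The order upgrade from its pieces** (2a, 2a → 2b, 2c, 2b → 2c → upgrade). -/
theorem stub_orderUpgrade_of :
    Sig.stub_landau → (Sig.stub_landau → Sig.stub_coneInterp) → Sig.stub_holeCone →
      (Sig.stub_coneInterp → Sig.stub_holeCone → Sig.stub_orderUpgrade) → Sig.stub_orderUpgrade :=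
  fun hA hAB hC hAsm ↦ hAsm (hAB hA) hC

/-- **The crux from the stubs.** Monotonicity of tame genericity in the property: for an
admissible datum satisfying the matrix of stub 1 and a maximal development that does not settle
(T2), stub 1 gives a tame coarse recurrent system and the order upgrade (stubs 2a–2d) upgrades it to
`RecursO k`; the result is the crux up to `δ`-unfolding of `RecursO` / `SettlesT2`
(`omegaLimitMultiKerr_iff`). -/
theorem OmegaLimitMultiKerr_of :
    Sig.stub_genericSettlesOrTameRecurs → Sig.stub_landau → (Sig.stub_landau → Sig.stub_coneInterp) →
      Sig.stub_holeCone → (Sig.stub_coneInterp → Sig.stub_holeCone → Sig.stub_orderUpgrade) →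
      OmegaLimitMultiKerr := by
  intro h₁ hA hAB hC hAsm
  have h₂ : Sig.stub_orderUpgrade := stub_orderUpgrade_of hA hAB hC hAsm
  refine omegaLimitMultiKerr_iff.mpr fun k X _ _ _ _ _ _ ↦ ?_
  exact isTameChristodoulouGeneric_mono (h₁ k X) fun D _ hP ↦
    ⟨hP.1, fun 𝒟 h𝒟 hS ↦ h₂ k X D 𝒟 (hP.2 𝒟 h𝒟 hS)⟩

/-- **… with the registered stubs plugged in**: the skeleton proves the crux by name modulo
exactly ONE `sorry`, the generic stub `stub_genericSettlesOrTameRecurs` (the summit pre-phase);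
`stub_landau`, `stub_coneInterp`, `stub_holeCone`, `stub_orderUpgradeAssembly` are the landed
theorems (wave 1 + lead, 2026-08-17). -/
theorem OmegaLimitMultiKerr_of_stubs : OmegaLimitMultiKerr :=
  OmegaLimitMultiKerr_of stub_genericSettlesOrTameRecurs stub_landau stub_coneInterp stub_holeCone
    stub_orderUpgradeAssembly

end Summit.FinalStateConjecture.FinalStateConjecture.Cruxes.OmegaLimitMultiKerr.Birth

end
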